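import Literature.MathematicalPhysics.QuantumLattice.HubbardHubbardModel
import Literature.MathematicalPhysics.QuantumLattice.FermionOperatorsProofs
import HarnessLib

/-!
# Discharge of `yang_etaPairing_pairAmplitude`: Yang's constant off-diagonal pair amplitude

Family `hubbard` (trunk T-QLATTICE), statement hubbard.S08. Sibling proof file of
`Literature/MathematicalPhysics/QuantumLattice/HubbardHubbardModel.lean`: it proves the named
fact `Literature.MathematicalPhysics.QuantumLattice.yang_etaPairing_pairAmplitude` (`def … : Prop`, D-0014) of that file from
Mathlib, the accepted prelude (`HubbardWave0`: `Fock`, `jwSign`, `annihilation`, `creation`,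
`vacuum`, `expect`; `FermionOperators`: `etaRaise`; `HubbardModel`: `etaPairingState`,
`FermionTorus`, `torusStagger`; `PairCorrelations`: `pairAmplitude`) and the accepted proof
file `FermionOperatorsProofs` (basis action `annihilation_mulVec_single`, Jordan–Wigner sign
lemmas, and the closed form `etaRaise_pow_mulVec_vacuum` of the `η`-tower
`(η†)^m |0⟩ = m! Σ_{#S = m} ε_S |P S⟩`). No statement is introduced or changed and no
definition is added: as in `FermionOperatorsProofs`, the paired orbital sets are handled
through an arbitrary `P : Finset Λ → Finset (Orb Λ)` with `i ∈ P S ↔ site(i) ∈ S`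
(e.g. `P S = (S ×ˢ univ).map toLex`).

Main results:

* `Literature.MathematicalPhysics.QuantumLattice.pairAnnihilation_mulVec_single_pairs` — `c_{z↓} c_{z↑} |P S⟩ = [z ∈ S] |P (S ∖ z)⟩`
  (no Jordan–Wigner sign on fully paired configurations), and its consequence
  `pairAnnihilation_mulVec_sum_pairs_succ`:
  `c_{z↓} c_{z↑} Σ_{#S = m+1} ε_S |P S⟩ = ε_z Σ_{#T = m, z ∉ T} ε_T |P T⟩`.
* `Literature.MathematicalPhysics.QuantumLattice.star_sum_pairs_dotProduct` — orthogonality count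
  `⟨Σ_{S ⊆ G, #S = m} ε_S |P S⟩, Σ_{S ⊆ G', #S = m} ε_S |P S⟩⟩ = #{S ⊆ G ∩ G' : #S = m}`.
* `Literature.MathematicalPhysics.QuantumLattice.pairAmplitude_etaPairingState` — for EVERY finite linearly ordered set of sites
  `Λ` (`M = |Λ|`), every sign function `ε : Λ → ℤˣ`, every `m` and all `x ≠ y`:
  `⟨ψ, c†_{x↑} c†_{x↓} c_{y↓} c_{y↑} ψ⟩ = ε_x ε_y · m (M - m) / (M (M - 1)) · ⟨ψ, ψ⟩`,
  `ψ = (η†_ε)^m |0⟩`; indeed `⟨ψ, ψ⟩ = (m!)² C(M, m)` and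
  `⟨ψ, c†_{x↑} c†_{x↓} c_{y↓} c_{y↑} ψ⟩ = (m!)² ε_x ε_y C(M - 2, m - 1)`.
* `Literature.Hubbard.yang_etaPairing_pairAmplitude_holds : yang_etaPairing_pairAmplitude` — the
  specialisation to the torus `(ℤ/Lℤ)²` (`M = L²`, `ε = torusStagger`), for every side `L`
  (the vendored fact carries no parity hypothesis and needs none: bipartiteness of `ε` enters
  only the eigenvector property `yang_etaPairing_eigenvector`, not the pair amplitude).

## Source and faithfulness

C. N. Yang, *η pairing and off-diagonal long-range order in a Hubbard model*, Phys. Rev. Lett.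
**63** (1989) 2144–2147 [cite: Yang1989, eqs. (9)–(10)]: for `ψ_N = (η†)^N |vac⟩` the
off-diagonal element of `ρ₂` between the on-site pairs at sites `r ≠ s` is
`e^{iπ·(r - s)} N (M - N) / (M (M - 1))` (`N` = number of `η` pairs, `M` = number of sites),
which is of order one, whence ODLRO. The PRL is paywalled and not held (acquisition request
filed); the printed constant is confirmed verbatim by the held secondary sources
Kaneko–Shirakawa–Sorella–Yunoki, PRL 122 (2019) 077002 = arXiv:1809.01865, p. 3
("`⟨φ_{N_η}| Δ†_i Δ_j |φ_{N_η}⟩ = N_η (L - N_η) / (L (L - 1)) e^{iπ(R_i - R_j)}` for `i ≠ j`",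
`N_η` pairs, `L` sites) and Amico–Fazio–Osterloh–Vedral, Rev. Mod. Phys. 80 (2008) 517 =
arXiv:quant-ph/0703044, p. 25 (`⟨η†_j η_k⟩ = N (L - N) / (L (L - 1))`). The vendored statement
(`m` pairs, `M = L²`, division-free form `… · ⟨ψ, ψ⟩`) is therefore exactly the printed one; it
is NOT mis-stated.

## Proof sketch (Yang's count)

Write `b†_z = c†_{z↑} c†_{z↓}`, `η† = Σ_z ε_z b†_z`, `ε_S = ∏_{x ∈ S} ε_x`, and let `|P S⟩` be the
basis vector of the configuration with the sites of `S` doubly occupied. By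
`etaRaise_pow_mulVec_vacuum`, `ψ = (η†)^m |0⟩ = m! Φ_m(Λ)` with
`Φ_m(G) = Σ_{S ⊆ G, #S = m} ε_S |P S⟩`. Below an orbital `(z, σ)` with `z` unoccupied a paired
configuration has an even number of orbitals, so `c_{z↓} c_{z↑} |P S⟩ = [z ∈ S] |P (S ∖ z)⟩`
with sign `+1`, whence `c_{z↓} c_{z↑} Φ_{m+1}(Λ) = ε_z Φ_m(Λ ∖ z)` (re-index
`(S ∋ z) ↔ (T = S ∖ z)`, `ε_S = ε_z ε_T`). Orthonormality of the `|P S⟩` and `ε_S² = 1` give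
`⟨Φ_k(G), Φ_k(G')⟩ = #{S ⊆ G ∩ G' : #S = k}`, so `⟨ψ, ψ⟩ = (m!)² C(M, m)` and
`⟨ψ, b†_x b_y ψ⟩ = ⟨b_x ψ, b_y ψ⟩ = (m!)² ε_x ε_y C(M - 2, m - 1)`; finally
`m (M - m) C(M, m) = M (M - 1) C(M - 2, m - 1)` (`Nat.add_one_mul_choose_eq`,
`Nat.choose_mul_succ_eq`). The cases `m = 0`, `m > M` are covered (both sides vanish), and
`M ≥ 2` because `x ≠ y`.
-/

open Matrix Finset Literature.MathematicalPhysics.QuantumLattice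

namespace Literature.MathematicalPhysics.QuantumLattice

section Fock

/-- `⟨c • v, d • w⟩ = conj c · d · ⟨v, w⟩` for the `star`-bilinear dot product. [folklore] -/
theorem star_smul_dotProduct_smul {κ : Type*} [Fintype κ] (c d : ℂ) (v w : κ → ℂ) :
    star (c • v) ⬝ᵥ (d • w) = star c * d * (star v ⬝ᵥ w) := by
  rw [star_smul, smul_dotProduct, dotProduct_smul, smul_eq_mul, smul_eq_mul]
  ring

end Fock

/-! ### Fully paired occupation sets -/

section Pairs

variable {Λ : Type*} [LinearOrder Λ] [Fintype Λ] {P : Finset Λ → Finset (Orb Λ)}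

omit [LinearOrder Λ] [Fintype Λ] in
/-- A pairing map `P` (`i ∈ P S ↔ site(i) ∈ S`) is the map `S ↦ S × {↑, ↓}` read in `Orb Λ`.
[folklore] -/
theorem pairs_eq_map_sprod (hP : ∀ S i, i ∈ P S ↔ (ofLex i).1 ∈ S) (S : Finset Λ) :
    P S = (S ×ˢ (univ : Finset (Fin 2))).map (Equiv.toEmbedding toLex) := by
  ext i
  simp [hP, mem_map_equiv]

omit [LinearOrder Λ] [Fintype Λ] in
/-- `P S` has `2 #S` orbitals. [folklore] -/
theorem card_pairs (hP : ∀ S i, i ∈ P S ↔ (ofLex i).1 ∈ S) (S : Finset Λ) :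
    (P S).card = S.card * 2 := by
  rw [pairs_eq_map_sprod hP, card_map, card_product, card_univ, Fintype.card_fin]

omit [LinearOrder Λ] [Fintype Λ] in
/-- A pairing map is injective. [folklore] -/
theorem pairs_injective (hP : ∀ S i, i ∈ P S ↔ (ofLex i).1 ∈ S) : Function.Injective P := by
  intro S T h
  ext x
  have h0 := congrArg (fun U => orb x 0 ∈ U) h
  simpa [hP] using h0

omit [Fintype Λ] in
/-- Adding a site adds its two orbitals: `P (S ∪ {z}) = {(z, ↑), (z, ↓)} ∪ P S`. [folklore] -/
theorem pairs_insert (hP : ∀ S i, i ∈ P S ↔ (ofLex i).1 ∈ S) (z : Λ) (S : Finset Λ) :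
    P (insert z S) = insert (orb z 0) (insert (orb z 1) (P S)) := by
  ext i
  obtain ⟨⟨w, τ⟩, rfl⟩ : ∃ p, toLex p = i := ⟨ofLex i, rfl⟩
  simp only [hP, ofLex_toLex, mem_insert]
  constructor
  · rintro (rfl | h)
    · fin_cases τ <;> simp
    · exact Or.inr (Or.inr h)
  · rintro (h | h | h)
    · left; simpa using congrArg (fun o => (ofLex o).1) h
    · left; simpa using congrArg (fun o => (ofLex o).1) h
    · exact Or.inr h

omit [Fintype Λ] in
/-- Removing the `↑` orbital of an occupied site: `P S ∖ {(z, ↑)} = {(z, ↓)} ∪ P (S ∖ {z})`.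
[folklore] -/
theorem pairs_erase_orb_zero (hP : ∀ S i, i ∈ P S ↔ (ofLex i).1 ∈ S) {z : Λ} {S : Finset Λ}
    (hz : z ∈ S) : (P S).erase (orb z 0) = insert (orb z 1) (P (S.erase z)) := by
  have h := pairs_insert hP z (S.erase z)
  rw [insert_erase hz] at h
  rw [h, erase_insert]
  simp [hP]

omit [Fintype Λ] in
/-- The orbitals of `P S` below `(z, σ)`, for an unoccupied site `z`, are the pairs over the
sites of `S` below `z`. [folklore] -/
theorem filter_pairs_lt_orb (hP : ∀ S i, i ∈ P S ↔ (ofLex i).1 ∈ S) {z : Λ} {S : Finset Λ}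
    (hz : z ∉ S) (σ : Fin 2) : (P S).filter (· < orb z σ) = P (S.filter (· < z)) := by
  ext i
  obtain ⟨⟨w, τ⟩, rfl⟩ : ∃ p, toLex p = i := ⟨ofLex i, rfl⟩
  simp only [mem_filter, hP, ofLex_toLex, Prod.Lex.toLex_lt_toLex]
  constructor
  · rintro ⟨hw, h | ⟨rfl, -⟩⟩
    · exact ⟨hw, h⟩
    · exact absurd hw hz
  · rintro ⟨hw, h⟩
    exact ⟨hw, Or.inl h⟩

omit [Fintype Λ] in
/-- Jordan–Wigner signs are trivial on paired configurations: `jwSign (z, σ) (P S) = 1` for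
`z ∉ S` (the orbitals below `(z, σ)` come in pairs). [folklore] -/
theorem jwSign_orb_pairs (hP : ∀ S i, i ∈ P S ↔ (ofLex i).1 ∈ S) {z : Λ} {S : Finset Λ}
    (hz : z ∉ S) (σ : Fin 2) : jwSign (orb z σ) (P S) = 1 := by
  rw [jwSign, filter_pairs_lt_orb hP hz, card_pairs hP, mul_comm, pow_mul, neg_one_sq, one_pow]

/-- **Pair annihilation on a paired configuration**: `c_{z↓} c_{z↑} |P S⟩ = |P (S ∖ {z})⟩` if
`z ∈ S` and `0` otherwise — both Jordan–Wigner signs are `+1`, because `(z, ↑) < (z, ↓)` are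
adjacent and the orbitals of `P S` below them come in pairs. Companion of
`pairCreation_mulVec_single_pairs`. Yang, PRL 63 (1989) 2144, the computation leading to
eq. (10). [folklore] -/
theorem pairAnnihilation_mulVec_single_pairs (hP : ∀ S i, i ∈ P S ↔ (ofLex i).1 ∈ S) (z : Λ)
    (S : Finset Λ) :
    (annihilation (orb z 1) * annihilation (orb z 0)) *ᵥ Pi.single (P S) (1 : ℂ) =
      if z ∈ S then Pi.single (P (S.erase z)) 1 else 0 := by
  have h0 : orb z 0 ∈ P S ↔ z ∈ S := by simp [hP]
  rw [← mulVec_mulVec, QuantumLattice.annihilation_mulVec_single]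
  by_cases hz : z ∈ S
  · have hz' : z ∉ S.erase z := notMem_erase z S
    have h1 : orb z 1 ∉ P (S.erase z) := by simp [hP]
    have h10 : ¬orb z 1 < orb z 0 := by simp [Prod.Lex.toLex_lt_toLex]
    have hS : jwSign (orb z 0) (P S) = 1 := by
      rw [← insert_erase hz, pairs_insert hP, QuantumLattice.jwSign_insert_of_not_lt (lt_irrefl _),
        QuantumLattice.jwSign_insert_of_not_lt h10, jwSign_orb_pairs hP hz']
    rw [if_pos (h0.2 hz), hS, one_smul, pairs_erase_orb_zero hP hz,
      QuantumLattice.annihilation_mulVec_single, if_pos (mem_insert_self _ _),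
      QuantumLattice.jwSign_insert_of_not_lt (lt_irrefl _), jwSign_orb_pairs hP hz', one_smul,
      erase_insert h1, if_pos hz]
  · rw [if_neg (mt h0.1 hz), mulVec_zero, if_neg hz]

/-! ### Signed sums of paired configurations -/

omit [LinearOrder Λ] [Fintype Λ] in
/-- `ε_S` is real: `star (∏_{x ∈ S} ε_x) = ∏_{x ∈ S} ε_x` for `ε : Λ → ℤˣ`. [folklore] -/
theorem star_prod_sign (ε : Λ → ℤˣ) (S : Finset Λ) :
    star (∏ x ∈ S, ((ε x : ℤ) : ℂ)) = ∏ x ∈ S, ((ε x : ℤ) : ℂ) := by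
  simp [star_prod]

omit [LinearOrder Λ] [Fintype Λ] in
/-- `ε_S² = 1` for `ε : Λ → ℤˣ`. [folklore] -/
theorem prod_sign_mul_self (ε : Λ → ℤˣ) (S : Finset Λ) :
    (∏ x ∈ S, ((ε x : ℤ) : ℂ)) * ∏ x ∈ S, ((ε x : ℤ) : ℂ) = 1 := by
  rw [← prod_mul_distrib]
  refine prod_eq_one fun x _ => ?_
  rw [← Int.cast_mul, ← Units.val_mul, Int.units_mul_self, Units.val_one, Int.cast_one]

omit [Fintype Λ] in
/-- `m`-subsets of `G` which are also `m`-subsets of `G'`. [folklore] -/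
theorem powersetCard_inter_powersetCard (m : ℕ) (G G' : Finset Λ) :
    powersetCard m G ∩ powersetCard m G' = powersetCard m (G ∩ G') := by
  ext S
  simp only [mem_inter, mem_powersetCard, subset_inter_iff]
  tauto

/-- Reindexing the `(m+1)`-subsets containing `z` by their complements in `z`:
`Σ_{#S = m+1, z ∈ S} g(S) = Σ_{#T = m, T ⊆ Λ ∖ z} g(T ∪ {z})`. [folklore] -/
theorem sum_powersetCard_succ_filter_mem {β : Type*} [AddCommMonoid β] (z : Λ) (m : ℕ)
    (g : Finset Λ → β) :
    ∑ S ∈ (powersetCard (m + 1) (univ : Finset Λ)).filter (fun S => z ∈ S), g S =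
      ∑ T ∈ powersetCard m (univ.erase z), g (insert z T) := by
  refine sum_nbij' (fun S => S.erase z) (fun T => insert z T) ?_ ?_ ?_ ?_ ?_
  · intro S hS
    simp only [mem_filter, mem_powersetCard] at hS
    simp only [mem_powersetCard, subset_erase]
    exact ⟨⟨subset_univ _, notMem_erase z S⟩, by rw [card_erase_of_mem hS.2, hS.1.2]; rfl⟩
  · intro T hT
    simp only [mem_powersetCard, subset_erase] at hT
    simp only [mem_filter, mem_powersetCard]
    exact ⟨⟨subset_univ _, by rw [card_insert_of_notMem hT.1.2, hT.2]⟩, mem_insert_self z T⟩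
  · intro S hS
    simp only [mem_filter] at hS
    exact insert_erase hS.2
  · intro T hT
    simp only [mem_powersetCard, subset_erase] at hT
    exact erase_insert hT.1.2
  · intro S hS
    simp only [mem_filter] at hS
    rw [insert_erase hS.2]

/-- **Pair annihilation lowers the signed configuration sums**:
`c_{z↓} c_{z↑} Σ_{#S = m+1} ε_S |P S⟩ = ε_z Σ_{#T = m, T ⊆ Λ ∖ z} ε_T |P T⟩` (each configuration
containing `z` loses `z`, with `ε_S = ε_z ε_{S ∖ z}`). Yang, PRL 63 (1989) 2144, the count
leading to eq. (10). [folklore] -/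
theorem pairAnnihilation_mulVec_sum_pairs_succ (hP : ∀ S i, i ∈ P S ↔ (ofLex i).1 ∈ S)
    (ε : Λ → ℤˣ) (m : ℕ) (z : Λ) :
    (annihilation (orb z 1) * annihilation (orb z 0)) *ᵥ
        (∑ S ∈ powersetCard (m + 1) (univ : Finset Λ),
          (∏ x ∈ S, ((ε x : ℤ) : ℂ)) • Pi.single (P S) (1 : ℂ)) =
      ((ε z : ℤ) : ℂ) • ∑ T ∈ powersetCard m (univ.erase z),
        (∏ x ∈ T, ((ε x : ℤ) : ℂ)) • Pi.single (P T) (1 : ℂ) := by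
  simp only [mulVec_sum, mulVec_smul, pairAnnihilation_mulVec_single_pairs hP, smul_ite,
    smul_zero]
  rw [← sum_filter, sum_powersetCard_succ_filter_mem, smul_sum]
  refine sum_congr rfl fun T hT => ?_
  have hzT : z ∉ T := (subset_erase.1 (mem_powersetCard.1 hT).1).2
  rw [erase_insert hzT, prod_insert hzT, smul_smul]

/-- Pair annihilation kills the empty configuration `Σ_{#S = 0} ε_S |P S⟩ = |0⟩`. [folklore] -/
theorem pairAnnihilation_mulVec_sum_pairs_zero (hP : ∀ S i, i ∈ P S ↔ (ofLex i).1 ∈ S)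
    (ε : Λ → ℤˣ) (z : Λ) :
    (annihilation (orb z 1) * annihilation (orb z 0)) *ᵥ
        (∑ S ∈ powersetCard 0 (univ : Finset Λ),
          (∏ x ∈ S, ((ε x : ℤ) : ℂ)) • Pi.single (P S) (1 : ℂ)) = 0 := by
  rw [powersetCard_zero, sum_singleton, mulVec_smul, pairAnnihilation_mulVec_single_pairs hP,
    if_neg (notMem_empty z), smul_zero]

/-- **Orthogonality count**: `⟨Σ_{S ⊆ G, #S = m} ε_S |P S⟩, Σ_{S ⊆ G', #S = m} ε_S |P S⟩⟩ =
#{S ⊆ G ∩ G' : #S = m}` (the `|P S⟩` are orthonormal and `ε_S² = 1`). Yang, PRL 63 (1989)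
2144, the count leading to eq. (10). [folklore] -/
theorem star_sum_pairs_dotProduct (hP : ∀ S i, i ∈ P S ↔ (ofLex i).1 ∈ S) (ε : Λ → ℤˣ)
    (m : ℕ) (G G' : Finset Λ) :
    star (∑ S ∈ powersetCard m G, (∏ x ∈ S, ((ε x : ℤ) : ℂ)) • Pi.single (P S) (1 : ℂ)) ⬝ᵥ
        (∑ S ∈ powersetCard m G', (∏ x ∈ S, ((ε x : ℤ) : ℂ)) • Pi.single (P S) (1 : ℂ)) =
      ((powersetCard m (G ∩ G')).card : ℂ) := by
  have hstar : star (∑ S ∈ powersetCard m G, (∏ x ∈ S, ((ε x : ℤ) : ℂ)) • Pi.single (P S) (1 : ℂ)) =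
      ∑ S ∈ powersetCard m G, (∏ x ∈ S, ((ε x : ℤ) : ℂ)) • Pi.single (P S) (1 : ℂ) := by
    simp only [star_sum, star_smul, star_prod_sign, ← Pi.single_star, star_one]
  calc star (∑ S ∈ powersetCard m G, (∏ x ∈ S, ((ε x : ℤ) : ℂ)) • Pi.single (P S) (1 : ℂ)) ⬝ᵥ
        (∑ S ∈ powersetCard m G', (∏ x ∈ S, ((ε x : ℤ) : ℂ)) • Pi.single (P S) (1 : ℂ))
      = ∑ S ∈ powersetCard m G, ∑ S' ∈ powersetCard m G',
          (∏ x ∈ S, ((ε x : ℤ) : ℂ)) *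
            ((∏ x ∈ S', ((ε x : ℤ) : ℂ)) * if S = S' then 1 else 0) := by
        rw [hstar, sum_dotProduct]
        refine sum_congr rfl fun S _ => ?_
        rw [dotProduct_sum]
        refine sum_congr rfl fun S' _ => ?_
        rw [smul_dotProduct, dotProduct_smul, single_dotProduct, one_mul, smul_eq_mul, smul_eq_mul]
        simp only [Pi.single_apply, (pairs_injective hP).eq_iff]
    _ = ∑ S ∈ powersetCard m G, if S ∈ powersetCard m G' then (1 : ℂ) else 0 := by
        refine sum_congr rfl fun S _ => ?_
        simp_rw [mul_ite, mul_one, mul_zero]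
        rw [sum_ite_eq]
        split_ifs <;> simp [prod_sign_mul_self]
    _ = ((powersetCard m (G ∩ G')).card : ℂ) := by
        rw [sum_boole, filter_mem_eq_inter, powersetCard_inter_powersetCard]

/-- The pair amplitude as an inner product of lowered states:
`⟨ψ, c†_{x↑} c†_{x↓} c_{y↓} c_{y↑} ψ⟩ = ⟨c_{x↓} c_{x↑} ψ, c_{y↓} c_{y↑} ψ⟩`. [folklore] -/
theorem pairAmplitude_eq_star_mulVec_dotProduct (x y : Λ) (ψ : Fock (Orb Λ)) :
    pairAmplitude x y ψ =
      star ((annihilation (orb x 1) * annihilation (orb x 0)) *ᵥ ψ) ⬝ᵥ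
        ((annihilation (orb y 1) * annihilation (orb y 0)) *ᵥ ψ) := by
  rw [pairAmplitude, QuantumLattice.expect, star_mulVec, ← dotProduct_mulVec, mulVec_mulVec,
    conjTranspose_mul, annihilation_conjTranspose, annihilation_conjTranspose, ← mul_assoc]

end Pairs

/-! ### Yang's constant -/

section Constant

/-- The binomial identity behind Yang's constant: `(n+2)(n+1) C(n, k) = (k+1)(n+1-k) C(n+2, k+1)`,
i.e. `C(M-2, m-1) / C(M, m) = m (M - m) / (M (M - 1))` with `M = n + 2`, `m = k + 1`.
Yang, PRL 63 (1989) 2144, eq. (10). [folklore] -/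
theorem succ_succ_mul_succ_mul_choose (n k : ℕ) :
    (n + 1 + 1) * (n + 1) * n.choose k = (k + 1) * (n + 1 - k) * (n + 1 + 1).choose (k + 1) := by
  have h1 := Nat.add_one_mul_choose_eq n k
  have h2 := Nat.choose_mul_succ_eq (n + 1) (k + 1)
  have h3 : n + 1 + 1 - (k + 1) = n + 1 - k := by omega
  rw [h3] at h2
  calc (n + 1 + 1) * (n + 1) * n.choose k = (n + 1 + 1) * ((n + 1) * n.choose k) := by ring
    _ = (n + 1 + 1) * ((n + 1).choose (k + 1) * (k + 1)) := by rw [h1]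
    _ = ((n + 1).choose (k + 1) * (n + 1 + 1)) * (k + 1) := by ring
    _ = ((n + 1 + 1).choose (k + 1) * (n + 1 - k)) * (k + 1) := by rw [h2]
    _ = (k + 1) * (n + 1 - k) * (n + 1 + 1).choose (k + 1) := by ring

/-- Yang's constant times the number of configurations:
`yangPairAmplitude (n+2) (k+1) · C(n+2, k+1) = C(n, k)`. Yang, PRL 63 (1989) 2144, eq. (10).
[folklore] -/
theorem yangPairAmplitude_mul_choose (n k : ℕ) :
    yangPairAmplitude (n + 1 + 1) (k + 1) * (((n + 1 + 1).choose (k + 1) : ℕ) : ℝ) =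
      ((n.choose k : ℕ) : ℝ) := by
  unfold yangPairAmplitude
  have hM : ((n + 1 + 1 : ℕ) : ℝ) ≠ 0 := by positivity
  have hM' : ((n + 1 + 1 : ℕ) : ℝ) - 1 ≠ 0 := by
    rw [Nat.cast_add_one, add_sub_cancel_right]; positivity
  rcases le_or_gt k (n + 1) with hk | hk
  · have h : ((n + 1 + 1 : ℕ) : ℝ) * ((n + 1 : ℕ) : ℝ) * ((n.choose k : ℕ) : ℝ) =
        ((k + 1 : ℕ) : ℝ) * ((n + 1 - k : ℕ) : ℝ) * (((n + 1 + 1).choose (k + 1) : ℕ) : ℝ) := by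
      exact_mod_cast succ_succ_mul_succ_mul_choose n k
    rw [Nat.cast_sub hk] at h
    rw [div_mul_eq_mul_div, div_eq_iff (mul_ne_zero hM hM')]
    push_cast at h ⊢
    linear_combination h.symm
  · rw [Nat.choose_eq_zero_of_lt (by omega : n < k),
      Nat.choose_eq_zero_of_lt (by omega : n + 1 + 1 < k + 1)]
    simp

end Constant

/-! ### The pair amplitude of the `η`-pairing states -/

section Eta

variable {Λ : Type*} [LinearOrder Λ] [Fintype Λ]

/-- **Yang's constant off-diagonal pair amplitude** for a general finite set of sites `Λ`
(`M = |Λ|`) and an arbitrary sign function `ε : Λ → ℤˣ`: for `ψ = (η†_ε)^m |0⟩` and `x ≠ y`,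
`⟨ψ, c†_{x↑} c†_{x↓} c_{y↓} c_{y↑} ψ⟩ = ε_x ε_y · m (M - m) / (M (M - 1)) · ⟨ψ, ψ⟩`
(`⟨ψ, ψ⟩ = (m!)² C(M, m)`, `⟨ψ, b†_x b_y ψ⟩ = (m!)² ε_x ε_y C(M-2, m-1)`).
Yang, PRL 63 (1989) 2144, eqs. (9)–(10). [cite: Yang1989, eqs. (9)–(10)] -/
theorem pairAmplitude_etaPairingState (ε : Λ → ℤˣ) (m : ℕ) {x y : Λ} (hxy : x ≠ y) :
    pairAmplitude x y (etaPairingState ε m) =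
      (((ε x : ℤ) * (ε y : ℤ) * yangPairAmplitude (Fintype.card Λ) m : ℝ) : ℂ) *
        (star (etaPairingState ε m) ⬝ᵥ etaPairingState ε m) := by
  obtain ⟨P, hP⟩ : ∃ P : Finset Λ → Finset (Orb Λ), ∀ S i, i ∈ P S ↔ (ofLex i).1 ∈ S :=
    ⟨fun S => (S ×ˢ univ).map (Equiv.toEmbedding toLex), fun S i => by simp [mem_map_equiv]⟩
  have hψ : ∀ n : ℕ, etaPairingState ε n =
      (n.factorial : ℂ) • ∑ S ∈ powersetCard n (univ : Finset Λ),
        (∏ x ∈ S, ((ε x : ℤ) : ℂ)) • Pi.single (P S) (1 : ℂ) := fun n => by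
    rw [etaPairingState]
    exact etaRaise_pow_mulVec_vacuum hP ε n
  obtain ⟨n, hn⟩ : ∃ n, Fintype.card Λ = n + 1 + 1 := by
    have : 1 < Fintype.card Λ := Fintype.one_lt_card_iff.2 ⟨x, y, hxy⟩
    exact ⟨Fintype.card Λ - 2, by omega⟩
  cases m with
  | zero =>
    rw [pairAmplitude_eq_star_mulVec_dotProduct, hψ, mulVec_smul, mulVec_smul,
      pairAnnihilation_mulVec_sum_pairs_zero hP ε x, pairAnnihilation_mulVec_sum_pairs_zero hP ε y,
      smul_zero, star_zero, zero_dotProduct]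
    simp [yangPairAmplitude]
  | succ k =>
    have hB : ∀ z : Λ, (annihilation (orb z 1) * annihilation (orb z 0)) *ᵥ
        etaPairingState ε (k + 1) =
          (((k + 1).factorial : ℂ) * ((ε z : ℤ) : ℂ)) •
            ∑ T ∈ powersetCard k (univ.erase z),
              (∏ x ∈ T, ((ε x : ℤ) : ℂ)) • Pi.single (P T) (1 : ℂ) := by
      intro z
      rw [hψ, mulVec_smul, pairAnnihilation_mulVec_sum_pairs_succ hP, smul_smul]
    have hcard : (univ.erase x ∩ univ.erase y : Finset Λ).card = n := by
      have h1 : (univ.erase x ∩ univ.erase y : Finset Λ) = (univ.erase x).erase y := by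
        ext a
        simp only [mem_inter, mem_erase, mem_univ, and_true]
        tauto
      have hy : y ∈ (univ : Finset Λ).erase x := by simpa using hxy.symm
      rw [h1, card_erase_of_mem hy, card_erase_of_mem (mem_univ x), card_univ, hn]
      rfl
    have keyC : ((n.choose k : ℕ) : ℂ) =
        ((yangPairAmplitude (n + 1 + 1) (k + 1) : ℝ) : ℂ) *
          (((n + 1 + 1).choose (k + 1) : ℕ) : ℂ) := by
      have h := congrArg (fun r : ℝ => (r : ℂ)) (yangPairAmplitude_mul_choose n k)
      push_cast at h
      exact h.symm
    rw [pairAmplitude_eq_star_mulVec_dotProduct, hB, hB, star_smul_dotProduct_smul,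
      star_sum_pairs_dotProduct hP, card_powersetCard, hcard, hψ,
      star_smul_dotProduct_smul, star_sum_pairs_dotProduct hP, univ_inter, card_powersetCard,
      card_univ, hn, keyC]
    simp only [star_mul, star_natCast, star_intCast]
    push_cast
    ring

end Eta

/-- The fermionic torus `(ℤ/Lℤ)^d` has `L^d` sites. [folklore] -/
theorem card_fermionTorus (d L : ℕ) : Fintype.card (FermionTorus d L) = L ^ d := by
  simp [FermionTorus, Fintype.card_lex]

end Literature.MathematicalPhysics.QuantumLattice

namespace Literature.MathematicalPhysics.QuantumLattice


/-- **Discharge of hubbard.S08 (pair amplitude)**: Yang's constant off-diagonal pair amplitude of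
the `η`-pairing states on the torus `(ℤ/Lℤ)²`, `M = L²`, for every side `L` (no parity
hypothesis is needed: the identity holds for every sign function `ε`, here `ε = torusStagger`).
Yang, PRL 63 (1989) 2144, eqs. (9)–(10). [cite: Yang1989, eqs. (9)–(10)] -/
theorem yang_etaPairing_pairAmplitude_holds {L : ℕ} : yang_etaPairing_pairAmplitude (L := L) := by
  intro m x y hxy
  rw [← card_fermionTorus 2 L]
  exact pairAmplitude_etaPairingState torusStagger m hxy

end Literature.MathematicalPhysics.QuantumLattice
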